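import Summits.CriticalPhenomena.PercolationContinuityZ3.Theorems.Transplant.SqShadowVRoutingX
import Summits.CriticalPhenomena.PercolationContinuityZ3.Theorems.Transplant.SqShadowFact1Crossing
import Summits.CriticalPhenomena.PercolationContinuityZ3.Theorems.Transplant.SqShadowZ2
import Summits.CriticalPhenomena.PercolationContinuityZ3.Theorems.Transplant.BccSlabClearedSetX
import Literature.Barriers.CriticalPhenomena.BLPSCriticalReduction
import Literature.Probability.LatticeModels.PerfectMatchingCount
import Literature.Probability.Percolation.LatticeSymmetry
import Mathlib.Combinatorics.SimpleGraph.Prod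
import HarnessLib

/-!
# `F □ ℤ²` FOR A FINITE GRAPH `F` CARRIES A SQUARE SHADOW (the second projection) — the input substitution that puts Duminil-Copin–Sidoravicius–Tassion's
# remark "the same proof works for `ℤ² × G`, `G` finite" in the scope of the p205010-free square DST layer «SqShadow*»; scope for Burton–Keane; the
# cleared set `lift (block ∖ corner columns)` and the reduction of the exit-form certificate `ShapedLinkageX 3` to a COLUMN-LEVEL routing statement

builds on p205010 (kernel theorem, internal audit signed; external expert review pending) — NOT used in this file.
Lane `prim-bschramm`, seat `prim-bschramm-p2` (gen 50; class C1b = films / other 3D lattices at their own critical point, METHOD = input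
substitution; memo `HOME/bschramm/P2-LATTICES.md` §161); helper file (`--supports stmt-CriticalPhenomena-4575 --as helper`).

WHY.  The tree's `zdTimesFiniteOwnCriticalContinuity_two` («ZdTwoTimesFinite», p230168: `θ_{ℤ² □ F}((0,w), p_c) = 0` for every finite connected `F`) goes through
the Kozma–Nitzan/p205010 product node; in print the statement is Duminil-Copin–Sidoravicius–Tassion's remark after their Theorem 1 ("Two generalizations"),
never written out.  This file starts the p205010-FREE proof by INPUT SUBSTITUTION into the abstract square layer: the box product `F □ ℤ²` (Mathlib
`SimpleGraph.boxProd`; `(u,x) ∼ (v,y)` iff `u ∼ v ∧ x = y` or `u = v ∧ x ∼ y`) with the shadow `(u, x) ↦ x`.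
* §1 **`FinProdZ2.sqShadow F : SqShadow (F □ zdGraph 2)`** — bonds project to bonds or points, columns `F × {x}` are finite, period `1`, the translations /
  quarter turn / mirror of `ℤ²` act on the second factor (`liftIso`);
* §2 scope: `isQuasiTransitive`, cubic growth `ballVolume_le`, `isGraphAmenable`, Burton–Keane `numInfiniteClusters_le_one`, `connected`, `sh_surjective`,
  connected square lifts `exists_walk_in_lift_sqBall`; hence **`theta_criticalProb_eq_zero_of_shapedLinkageX`**: `θ_{F □ ℤ²}(v, p_c) = 0` for connected `F`
  from the finite routing certificate `(sqShadow F).ShapedLinkageX R`, any `R ≥ 1` («SqShadowVRoutingX»);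
* §3 the cleared set `clearedSet F z t s = lift (BccSlab.Dcols z t s)` (the clipped block of radius `3` minus its corner columns, «BccSlabClearedSetX»), the
  column-level routing statement **`FinProdZ2.ColRouting F`** and **`shapedLinkageX_of_colRouting`**, **`theta_criticalProb_eq_zero_of_colRouting`**.
The column-level statement is discharged uniformly in `F` in «ProdZ2HubRoute» (planar claw of the kernel table «BccClawXTable*» + three fibre levels) and
«ProdZ2Stacked» (the exceptional stacked family), assembled in «ProdZ2Route».
[cite: DuminilCopinSidoraviciusTassion2016, Thm. 1, §2.3 and p. 3 (remark "ℤ² × G, G finite")] [cite: BenjaminiSchramm1996, Conj. 4 / Question 3]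
[cite: BurtonKeane1989, Thm. 2] [cite: LyonsPeres2016, §6.1 (p. 279), Thm. 7.6]
-/

noncomputable section

namespace Summit.CriticalPhenomena.PercolationContinuityZ3.Theorems.Transplant

namespace FinProdZ2

open MeasureTheory Literature.Probability.Percolation Literature.Probability.LatticeModels SimpleGraph Filter
open Literature.Barriers.CriticalPhenomena (IsQuasiTransitive IsGraphAmenable HasExponentialGrowth graphBall ballVolume zdGraph_connected
  hasExponentialGrowth_of_not_isGraphAmenable BurtonKeane1989_atMostOneInfiniteCluster_holds)
open scoped Classical

variable {W : Type} (F : SimpleGraph W)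

/-! ## §1 The square shadow of `F □ ℤ²` -/

/-- The shadow of `F □ ℤ²`: the second projection. [cite: DuminilCopinSidoraviciusTassion2016, p. 3 (remark "ℤ² × G")] -/
def sh (v : W × Site 2) : Site 2 := v.2

/-- The shadow is the second projection. [folklore] -/
@[simp] theorem sh_mk (u : W) (x : Site 2) : sh (u, x) = x := rfl

/-- **Along a bond of `F □ ℤ²` the shadow stays or moves along a bond of `ℤ²`.** [folklore] -/
theorem lip {u v : W × Site 2} (h : (F □ zdGraph 2).Adj u v) : sh u = sh v ∨ (zdGraph 2).Adj (sh u) (sh v) := by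
  rcases (boxProd_adj).1 h with ⟨-, h2⟩ | ⟨h2, -⟩
  · exact Or.inl h2
  · exact Or.inr h2

/-- A bond of `F □ ℤ²` between different columns is a lattice bond of the shadows with equal fibre coordinates. [folklore] -/
theorem adj_of_sh_ne {u v : W × Site 2} (h : (F □ zdGraph 2).Adj u v) (hne : sh u ≠ sh v) : u.1 = v.1 ∧ (zdGraph 2).Adj (sh u) (sh v) := by
  rcases (boxProd_adj).1 h with ⟨-, h2⟩ | ⟨h2, h1⟩
  · exact absurd h2 hne
  · exact ⟨h1, h2⟩

/-- Columns are finite (`F` is finite). [folklore] -/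
theorem fibre_finite [Finite W] (z : Site 2) : {v : W × Site 2 | sh v = z}.Finite := by
  have : {v : W × Site 2 | sh v = z} ⊆ (Set.univ : Set W) ×ˢ ({z} : Set (Site 2)) := by
    rintro ⟨u, x⟩ hv; exact ⟨Set.mem_univ _, hv⟩
  exact (Set.finite_univ.prod (Set.finite_singleton z)).subset this

/-- **An automorphism of `ℤ²` acts on `F □ ℤ²` through the second factor.** [folklore] -/
def liftIso (τ : zdGraph 2 ≃g zdGraph 2) : (F □ zdGraph 2) ≃g (F □ zdGraph 2) where
  toEquiv := (Equiv.refl W).prodCongr τ.toEquiv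
  map_rel_iff' := by
    intro a b
    simp only [Equiv.prodCongr_apply, Prod.map, Equiv.refl_apply, boxProd_adj]
    rw [show τ.toEquiv a.2 = τ a.2 from rfl, show τ.toEquiv b.2 = τ b.2 from rfl, τ.map_rel_iff, τ.injective.eq_iff]

/-- `liftIso τ (u, x) = (u, τ x)`. [folklore] -/
@[simp] theorem liftIso_apply (τ : zdGraph 2 ≃g zdGraph 2) (v : W × Site 2) : liftIso F τ v = (v.1, τ v.2) := rfl

/-- The shadow of `liftIso τ v` is `τ (sh v)`. [folklore] -/
@[simp] theorem sh_liftIso (τ : zdGraph 2 ≃g zdGraph 2) (v : W × Site 2) : sh (liftIso F τ v) = τ (sh v) := rfl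

/-- **THE SQUARE SHADOW OF `F □ ℤ²`** (second projection; period `1`, centre `0`; translations `zdGraphShiftIso`, quarter turn `transposeIso ∘ reflectIso 0`,
mirror `reflectIso 1` lifted by `liftIso`). [cite: DuminilCopinSidoraviciusTassion2016, p. 3 (remark "ℤ² × G, G finite") and §2] -/
def sqShadow [Finite W] : SqShadow (F □ zdGraph 2) where
  sh := sh
  lip := fun _ _ h => lip F h
  fibre := fibre_finite
  period := 1
  period_pos := Nat.one_pos
  centre := 0
  shift := fun t => ⟨liftIso F (zdGraphShiftIso t), fun w => by simp [sh]⟩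
  rot := ⟨liftIso F (transposeIso.trans (reflectIso 0)), fun w => by
    rw [sh_liftIso, sub_zero, sub_zero]
    ext i; fin_cases i
    · show reflectIso 0 (transposeIso (sh w)) 0 = sqRot90 (sh w) 0
      rw [reflectIso_apply_same, transposeIso_apply_zero, sqRot90_apply_zero]
    · show reflectIso 0 (transposeIso (sh w)) 1 = sqRot90 (sh w) 1
      rw [reflectIso_apply_of_ne (by decide), transposeIso_apply_one, sqRot90_apply_one]⟩
  refl := ⟨liftIso F (reflectIso 1), fun w => by
    rw [sh_liftIso, sub_zero, sub_zero]
    ext i; fin_cases i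
    · show reflectIso 1 (sh w) 0 = sqFlip (sh w) 0
      rw [reflectIso_apply_of_ne (by decide), sqFlip_apply_zero]
    · show reflectIso 1 (sh w) 1 = sqFlip (sh w) 1
      rw [reflectIso_apply_same, sqFlip_apply_one]⟩

/-- The shadow map of `sqShadow F` is `sh`. [folklore] -/
@[simp] theorem sqShadow_sh [Finite W] : (sqShadow F).sh = sh := rfl

/-! ## §2 Scope: quasi-transitivity, cubic growth, amenability, uniqueness, connectedness, square lifts -/

/-- **`F □ ℤ²` is quasi-transitive** (the lifted translations; representatives `F × {0}`). [cite: BenjaminiSchramm1996, §2 (almost transitive graphs)] -/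
theorem isQuasiTransitive [Fintype W] : IsQuasiTransitive (F □ zdGraph 2) := by
  refine ⟨(Finset.univ : Finset W) ×ˢ {(0 : Site 2)}, fun v => ⟨liftIso F (zdGraphShiftIso (-v.2)), ?_⟩⟩
  simp

/-- Along a walk of `F □ ℤ²` of length `n` the shadow coordinates move by at most `n`. [folklore] -/
theorem abs_sh_sub_le_length {x y : W × Site 2} (w : (F □ zdGraph 2).Walk x y) (i : Fin 2) : |sh y i - sh x i| ≤ (w.length : ℤ) := by
  induction w with
  | nil => simp
  | @cons a b c hab w ih =>
    have h1 : |sh b i - sh a i| ≤ 1 := by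
      rcases lip F hab with he | ha
      · rw [he, sub_self, abs_zero]; exact zero_le_one
      · rw [abs_sub_comm]; exact zd2SqShadow.abs_sh_sub_sh_le_one ha i
    have h2 : |sh c i - sh a i| ≤ |sh c i - sh b i| + |sh b i - sh a i| := abs_sub_le _ _ _
    simp only [SimpleGraph.Walk.length_cons, Nat.cast_add, Nat.cast_one]
    linarith

/-- **Cubic volume growth**: `|B(x,n)| ≤ |F| · (2n+1)²`. [cite: LyonsPeres2016, §6.1 (growth of balls)] -/
theorem ballVolume_le [Fintype W] (x : W × Site 2) (n : ℕ) : ballVolume (F □ zdGraph 2) x n ≤ Fintype.card W * (2 * n + 1) ^ 2 := by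
  set f : W × Site 2 → W × ℤ × ℤ := fun y => (y.1, sh y 0 - sh x 0, sh y 1 - sh x 1) with hf
  have hinj : Function.Injective f := by
    rintro ⟨u, y⟩ ⟨u', y'⟩ h
    simp only [hf, Prod.mk.injEq, sh_mk] at h
    obtain ⟨rfl, h0, h1⟩ := h
    refine Prod.ext rfl ?_
    ext i; fin_cases i
    · show y 0 = y' 0; omega
    · show y 1 = y' 1; omega
  set S : Finset (W × ℤ × ℤ) := (Finset.univ : Finset W) ×ˢ (Finset.Icc (-(n : ℤ)) n ×ˢ Finset.Icc (-(n : ℤ)) n) with hS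
  have hsub : f '' graphBall (F □ zdGraph 2) x n ⊆ ↑S := by
    rintro _ ⟨y, ⟨w, hw⟩, rfl⟩
    have h0 := abs_sh_sub_le_length F w 0
    have h1 := abs_sh_sub_le_length F w 1
    have hn : (w.length : ℤ) ≤ n := by exact_mod_cast hw
    rw [abs_le] at h0 h1
    simp only [hS, hf, Finset.coe_product, Finset.coe_Icc, Set.mem_prod, Set.mem_Icc, Finset.coe_univ, Set.mem_univ, true_and]
    refine ⟨⟨?_, ?_⟩, ?_, ?_⟩ <;> linarith
  have hcard : S.card = Fintype.card W * (2 * n + 1) ^ 2 := by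
    rw [hS, Finset.card_product, Finset.card_product, Int.card_Icc, Finset.card_univ]
    have e1 : ((n : ℤ) + 1 - -(n : ℤ)).toNat = 2 * n + 1 := by omega
    rw [e1]; ring
  unfold ballVolume
  rw [← Set.ncard_image_of_injective _ hinj, ← hcard, ← Set.ncard_coe_finset]
  exact Set.ncard_le_ncard hsub S.finite_toSet

/-- `F □ ℤ²` does not have exponential growth (for non-empty `F`). [cite: Hutchcroft2016, §1 (exponential growth)] -/
theorem not_hasExponentialGrowth [Fintype W] [Nonempty W] : ¬ HasExponentialGrowth (F □ zdGraph 2) := by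
  intro h
  set x : W × Site 2 := (Classical.arbitrary W, 0) with hx
  obtain ⟨c, hc, hev⟩ := h x
  have hev2 := Literature.Barriers.CriticalPhenomena.eventually_pow_lt_const_pow 3 hc
  obtain ⟨n, ⟨hn1, hn2⟩, hnk⟩ := ((hev.and hev2).and (eventually_ge_atTop (Fintype.card W))).exists
  have hvol : (ballVolume (F □ zdGraph 2) x n : ℝ) ≤ Fintype.card W * (2 * n + 1) ^ 2 := by exact_mod_cast ballVolume_le F x n
  have hk' : (Fintype.card W : ℝ) ≤ 2 * n + 1 := by
    have : (Fintype.card W : ℝ) ≤ n := by exact_mod_cast hnk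
    linarith
  have hle : (Fintype.card W : ℝ) * (2 * n + 1) ^ 2 ≤ (2 * n + 1) ^ 3 := by
    rw [pow_succ, mul_comm]
    exact mul_le_mul_of_nonneg_left hk' (sq_nonneg _)
  linarith

/-- **`F □ ℤ²` is amenable** (subexponential growth + quasi-transitivity). [cite: LyonsPeres2016, §6.1 (p. 279)] -/
theorem isGraphAmenable [Fintype W] [Nonempty W] : IsGraphAmenable (F □ zdGraph 2) := by
  by_contra h
  exact not_hasExponentialGrowth F (hasExponentialGrowth_of_not_isGraphAmenable _ (isQuasiTransitive F) h)

/-- **`F □ ℤ²` is connected** for connected `F` (Mathlib `Connected.boxProd`). [folklore] -/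
theorem connected (hF : F.Connected) : (F □ zdGraph 2).Connected := hF.boxProd (zdGraph_connected 2)

/-- **Uniqueness of the infinite cluster on `F □ ℤ²`, connected `F`, every density** (Burton–Keane on the connected, quasi-transitive, amenable product).
[cite: BurtonKeane1989, Thm. 2] [cite: LyonsPeres2016, Thm. 7.6] -/
theorem numInfiniteClusters_le_one [Fintype W] (hF : F.Connected) (p : unitInterval) :
    ∀ᵐ ω ∂(bondPercolation (F □ zdGraph 2) p), numInfiniteClusters ω ≤ 1 := by
  haveI : Nonempty W := hF.nonempty
  exact BurtonKeane1989_atMostOneInfiniteCluster_holds _ (connected F hF) (isQuasiTransitive F) (isGraphAmenable F) p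

/-- Every column is inhabited (for non-empty `F`). [folklore] -/
theorem sh_surjective [Nonempty W] : Function.Surjective (sh (W := W)) := fun z => ⟨(Classical.arbitrary W, z), rfl⟩

/-- **The lift of every lattice square is connected inside itself** for connected `F`: move in the column to the other fibre coordinate (Mathlib
`Walk.boxProdLeft`), then along the square at that level (`Walk.boxProdRight` of «SqShadowFact1Crossing».`exists_walk_in_sqBall`). [folklore] -/
theorem exists_walk_in_lift_sqBall [Finite W] (hF : F.Connected) (c : Site 2) (u : ℕ) :
    ∀ a ∈ (sqShadow F).lift (sqBall c u), ∀ b ∈ (sqShadow F).lift (sqBall c u),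
      ∃ p : (F □ zdGraph 2).Walk a b, ∀ v ∈ p.support, v ∈ (sqShadow F).lift (sqBall c u) := by
  rintro ⟨ga, xa⟩ ha ⟨gb, xb⟩ hb
  rw [SqShadow.mem_lift, sqShadow_sh, sh_mk] at ha hb
  obtain ⟨w₁⟩ := hF.preconnected ga gb
  obtain ⟨w₂, hw₂⟩ := SqShadow.exists_walk_in_sqBall ha hb
  refine ⟨(w₁.boxProdLeft (zdGraph 2) xa).append (w₂.boxProdRight F gb), fun v hv => ?_⟩
  rw [SqShadow.mem_lift, sqShadow_sh]
  have hs₁ : (w₁.boxProdLeft (zdGraph 2) xa).support = w₁.support.map (fun g => (g, xa)) := by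
    unfold Walk.boxProdLeft; exact Walk.support_map _ _
  have hs₂ : (w₂.boxProdRight F gb).support = w₂.support.map (fun x => (gb, x)) := by
    unfold Walk.boxProdRight; exact Walk.support_map _ _
  rw [Walk.mem_support_append_iff, hs₁, hs₂, List.mem_map, List.mem_map] at hv
  rcases hv with ⟨g, -, rfl⟩ | ⟨x, hx, rfl⟩
  · exact ha
  · exact hw₂ x hx

/-- **`θ_{F □ ℤ²}(v, p_c) = 0` FOR CONNECTED FINITE `F` FROM THE FINITE ROUTING CERTIFICATE `ShapedLinkageX R`, any `R ≥ 1`** — Duminil-Copin–Sidoravicius–Tassion's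
proof transplanted through the square shadow (square DST layer «SqShadow*» with the exit-form routing «SqShadowVRoutingX»; connectedness, Burton–Keane uniqueness,
inhabited columns and connected square lifts discharged here).  Independent of p205010.
[cite: DuminilCopinSidoraviciusTassion2016, Thm. 1, §2 and p. 3 (remark "ℤ² × G, G finite")] [cite: BenjaminiSchramm1996, Conj. 4 / Question 3] -/
theorem theta_criticalProb_eq_zero_of_shapedLinkageX [Fintype W] (hF : F.Connected) {R : ℕ} (hR : 1 ≤ R) (hL : (sqShadow F).ShapedLinkageX R) (v : W × Site 2) :
    theta (F □ zdGraph 2) v (criticalProbIOf (F □ zdGraph 2) v) = 0 := by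
  haveI : Nonempty W := hF.nonempty
  exact (sqShadow F).theta_criticalProb_eq_zero_of_shapedLinkageX (connected F hF) (numInfiniteClusters_le_one F hF)
    (by rw [sqShadow_sh]; exact sh_surjective) (fun c u _ => exists_walk_in_lift_sqBall F hF c u) hL hR v

/-! ## §3 The cleared set `lift (block ∖ corners)` and the column-level routing statement -/

open BccSlab (cornerCols Dcols extCols tgtCols mem_Dcols mem_cornerCols mem_extCols mem_tgtCols mem_Dcols_of_sqBall_one inWin_mono)

/-- **THE CLEARED SET**: all vertices of `F □ ℤ²` over the cleared columns `Dcols z t s` (the clipped block `sqBlkR 3 z t s` minus its four corner columns,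
«BccSlabClearedSetX»). [cite: DuminilCopinSidoraviciusTassion2016, §2.3 (proof of Fact 2: the ball B̄_R(z))] -/
def clearedSet (z : Site 2) (t s : ℕ) : Set (W × Site 2) := {x | sh x ∈ Dcols z t s}

/-- Membership in the cleared set is a column condition. [folklore] -/
@[simp] theorem mem_clearedSet {z : Site 2} {t s : ℕ} {x : W × Site 2} : x ∈ clearedSet (W := W) z t s ↔ sh x ∈ Dcols z t s := Iff.rfl

/-- The cleared set is the lift of the cleared columns. [folklore] -/
theorem clearedSet_eq_lift [Finite W] (z : Site 2) (t s : ℕ) : clearedSet (W := W) z t s = (sqShadow F).lift (Dcols z t s) := rfl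

/-- **A cleared vertex with a non-cleared neighbour over the window sits over a target column** (the bond is a lattice bond: a fibre neighbour of a cleared
vertex is cleared). [folklore] -/
theorem tgtCol_of_adj {z : Site 2} {t s : ℕ} {x o : W × Site 2} (hx : x ∈ clearedSet (W := W) z t s) (hadj : (F □ zdGraph 2).Adj x o)
    (ho : o ∉ clearedSet (W := W) z t s) (hwin : SqShadow.InWin z t s (sh o)) : sh x ∈ tgtCols z t s := by
  have hne : sh x ≠ sh o := fun h => ho (by rw [mem_clearedSet, ← h]; exact hx)
  exact ⟨hx, sh o, (adj_of_sh_ne F hadj hne).2, hwin, ho⟩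

/-- **COLUMN-LEVEL ROUTING for `F □ ℤ²`** (what the uniform 3D templates discharge): for every centre `z` and block pair `sqBlkR 3 z t_R s_R ⊆ sqBlkR 3 z t_D s_D`
clipped in at most one direction, all vertices `E₁ ≠ E₂` over target columns of the rerouting block other than `z`, and `w'` over a target column different from
theirs, a SWAP PAIR of `VRouteData` with rerouted piece in `W ∩ lift (sqBlkR 3 z t_R s_R)` and branch in `W = clearedSet z t_D s_D`.  An internal obligation, never
asserted. [cite: DuminilCopinSidoraviciusTassion2016, §2.3 (proof of Fact 2: the three disjoint paths in B̄_R(z))] -/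
def ColRouting {W : Type} [Fintype W] (F : SimpleGraph W) : Prop :=
  ∀ (z : Site 2) (tR tD sR sD : ℕ), tR ≤ tD → sR ≤ sD → (3 ≤ tR ∨ 3 ≤ sR) →
    ∀ (E₁ E₂ w' : W × Site 2), E₁ ≠ E₂ →
      sh E₁ ∈ tgtCols z tD sD → sh E₁ ∈ sqBlkR 3 z tR sR → sh E₁ ≠ z →
      sh E₂ ∈ tgtCols z tD sD → sh E₂ ∈ sqBlkR 3 z tR sR → sh E₂ ≠ z →
      sh w' ∈ tgtCols z tD sD → sh w' ≠ sh E₁ → sh w' ≠ sh E₂ →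
        ∃ r₁ r₂ : VRouteData (F □ zdGraph 2) (clearedSet z tD sD ∩ (sqShadow F).lift (sqBlkR 3 z tR sR)) (clearedSet z tD sD) E₁ E₂ w',
          r₁.y = r₂.b ∧ r₁.b = r₂.y

/-- **REDUCTION: column-level routing gives the exit-form certificate `ShapedLinkageX 3` with the cleared set `W = lift (block ∖ corners)`.**  The terminal
data `TerminalsX 3 z t_R t_D s_R s_D W E₁ E₂ w'` supply `E₁ ≠ E₂` in `W` over `sqBlkR 3 z t_R s_R`, not over `z`, each with a neighbour `oᵢ ∉ W` over the `γ`-window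
(so over target columns), and `w' ∈ W` off their columns with an exit neighbour `x ∉ W` over the exit window (a target column too).
[cite: DuminilCopinSidoraviciusTassion2016, §2.3 (proof of Fact 2)] -/
theorem shapedLinkageX_of_colRouting [Fintype W] (H : ColRouting F) : (sqShadow F).ShapedLinkageX 3 := by
  intro z tR tD sR sD htRD hsRD hone
  have hts : 3 ≤ tD ∨ 3 ≤ sD := hone.imp (fun h => h.trans htRD) (fun h => h.trans hsRD)
  refine ⟨clearedSet z tD sD, fun x hx => hx.1, fun x h1 hB => mem_Dcols_of_sqBall_one hts h1 hB, fun E₁ E₂ w' hT => ?_⟩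
  obtain ⟨o₁, a₁, a₂, o₂, ho₁, -, -, ho₂, ho₁W, ho₂W, hwo₁, -, -, hwo₂, -⟩ := hT.nbrs
  obtain ⟨x, hx, hxW, hxwin, -, -, -⟩ := hT.w'x
  have hT₁ : sh E₁ ∈ tgtCols z tD sD := tgtCol_of_adj F hT.E₁W ho₁.symm ho₁W (inWin_mono hsRD hwo₁)
  have hT₂ : sh E₂ ∈ tgtCols z tD sD := tgtCol_of_adj F hT.E₂W ho₂ ho₂W (inWin_mono hsRD hwo₂)
  have hT₃ : sh w' ∈ tgtCols z tD sD := tgtCol_of_adj F hT.w'W hx hxW hxwin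
  exact H z tR tD sR sD htRD hsRD hone E₁ E₂ w' hT.ne hT₁ hT.E₁R hT.E₁z hT₂ hT.E₂R hT.E₂z hT₃ hT.w'E₁ hT.w'E₂

/-- **`θ_{F □ ℤ²}(v, p_c(F □ ℤ²)) = 0` FROM COLUMN-LEVEL ROUTING**, connected finite `F` — p205010-free (the square DST layer «SqShadow*» with the exit-form routing
«SqShadowVRoutingX», the cleared set above). [cite: DuminilCopinSidoraviciusTassion2016, Thm. 1 and §2.3] [cite: BenjaminiSchramm1996, Conj. 4 / Question 3] -/
theorem theta_criticalProb_eq_zero_of_colRouting [Fintype W] (hF : F.Connected) (H : ColRouting F) (v : W × Site 2) :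
    theta (F □ zdGraph 2) v (criticalProbIOf (F □ zdGraph 2) v) = 0 :=
  theta_criticalProb_eq_zero_of_shapedLinkageX F hF (by norm_num : (1 : ℕ) ≤ 3) (shapedLinkageX_of_colRouting F H) v

end FinProdZ2

end Summit.CriticalPhenomena.PercolationContinuityZ3.Theorems.Transplant

end
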